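import Summits.BirchSwinnertonDyer.Rank1Residual.X11b.TamagawaQuadraticBaseChange
import Summits.BirchSwinnertonDyer.Rank1Residual.X2.TwistTamagawa
import Literature.NumberTheory.EllipticCurves.HeegnerPointsKolyvaginGoodReductionProofs
import HarnessLib

/-!
# The Tamagawa relation in a quadratic base change at EVERY ODD prime under the classical Heegner
# hypothesis: `ord_p ∏_w c_w(E/K) = ord_p ∏_ℓ c_ℓ(E) + ord_p ∏_ℓ c_ℓ(E^{(d_K)}) = 2·ord_p ∏_ℓ c_ℓ(E)`

HONEST FRAMING (cell `b2b-bsdres`, run/shared/lean/b2b/bsd-rank1-residual/; verbatim): the goal is to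
DELETE the COMBINATION-SHAPED residual classes for ALL analytic-rank `≤ 1` curves over `ℚ` — "full BSD
formula for every rank `≤ 1` curve in class `C`" assembled STRICTLY from published theorems — so
that the rank-`≤ 1` remainder becomes exactly the CONSTRUCTION-SHAPED classes, which are TYPED
(missing-input `Prop`s), NOT attempted; this is not "finishing BSD". NEW WORK of the cell (elementary
local bookkeeping over decls already in the tree), hence under `Summits/`; NO definition, NO named
fact, nothing about any particular curve asserted; no label moves. Unit `b2b-bsdres-lit-cgls`
(off-peak literature typer: Castella–Grossi–Lee–Skinner 2022 / Greenberg–Vatsal 2000), session 4.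

## What this file does

The descent `K → ℚ` of the rank-one rows (Gross–Zagier V.§2 / Jetchev–Skinner–Wan 2017 §7.4.1 /
Castella 2018 §5 / Castella–Grossi–Lee–Skinner 2022 (5.6)–(5.7)) uses the "immediate relation"
`Σ_{w∣ℓ} ord_p c_w(E/K) = ord_p c_ℓ(E) + ord_p c_ℓ(E^K)` (CGLS: "for any prime `ℓ` (see
[Skinner–Zhang, Cor. 9.2])"; JSW (eq:tamK)). Sub-cell multr1-p1 proved it place by place for
`p ≥ 5` and every quadratic `K` whose non-split bad primes are multiplicative with `E[p]` ramified
(`X11b.padicValNat_sum_fibre_eq`, through the Kodaira–Néron bound `c ≤ 4 < p` at the non-split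
places); eisenstein-p2 proved the TWIST half `ord_p c_ℓ(E^{(d_K)}) = ord_p c_ℓ(E)` at every ODD
`p ∤ d_K` under the classical Heegner hypothesis with `d_K` odd
(`X2.padicValNat_localTamagawaNumber_twist_eq_of_odd`: at `ℓ ∣ d_K` the twist is of type `I₀*`,
`c ∈ {1,2,4}`). This file supplies the BASE-CHANGE half at every odd `p ∤ d_K` under the same
hypotheses, so that the (5.5)-level route of row C6 (`Partition/MainConjecturesEisensteinHeegner.lean`)
and the derivation (5.5) ⇒ (5.7) (`Partition/MainConjecturesEisensteinTwistIdentity.lean`) run at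
`p = 3` as well:

* `padicValNat_tamagawaProduct_baseChange_eq_of_fibre` — the fibrewise regrouping, ONCE: if for every
  finite place `v` of `ℚ` `Σ_{w∣v} ord_p c_w(E_K) = ord_p c_v(E) + ord_p c_v(Wd)`, then
  `ord_p ∏_w c_w(E/K) = ord_p ∏_v c_v(E) + ord_p ∏_v c_v(Wd)` (the proof transcript of
  `X11b.padicValNat_tamagawaProduct_baseChange_quadratic`, with the per-place identity abstracted).
* `padicValNat_sum_fibre_eq_of_heegner_of_odd` — the per-place identity for `p ≠ 2`, `p ∤ d_K`, `K`
  imaginary quadratic with `d_K` odd and EVERY `ℓ ∣ N` split (classical Heegner hypothesis),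
  `Wd = C • E^{(d_K)}`: split `v` — as in multr1-p1's proof (`c_{w₁} = c_{w₂} = c_v(E)`,
  `d_K ∈ (ℚ_v^×)²`, `c_v(Wd) = c_v(E)`); non-split `v` — then `ℓ ∤ N`, so `E` is good at `v`
  (`c_v(E) = 1`), `E/K` is good at the unique `w ∣ v` (`c_w(E/K) = 1`, Silverman VII.5.1(a):
  `hasGoodReductionAt_baseChange_of_hasGoodReductionAt_rat`), and `ord_p c_v(Wd) = ord_p c_v(E) = 0`
  by eisenstein-p2's twist lemma (moved from `ℚ_ℓ` to the adic completion by
  `localTamagawaNumber_padic_eq_holds`).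
* `padicValNat_tamagawaProduct_baseChange_quadratic_of_heegner_of_odd`,
  `padicValNat_tamagawaProduct_baseChange_quadratic_eq_two_mul_of_heegner_of_odd` — the global
  identities at every odd `p ∤ d_K` (for the rows' admissible `K`, `p` splits in `K`, so `p ∤ d_K`).

References: [CastellaGrossiLeeSkinner2022] proof of Thm. 5.3.1, sentence before (5.7);
[SkinnerZhang2014] Cor. 9.2 (as cited there); [JetchevSkinnerWan2017] §7.3.1 (eq:tamK);
[Castella2018] §5 (p. 12); [SilvermanAEC2009] VII.5.1(a), VII.6 Ex. 7.6; [SilvermanATAEC1994]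
IV.9 Table 4.1. Deliverable: HOME/b2b-bsdres-lit-cgls/CGLS-GV-TYPING.md §11 (session 4).
-/

set_option autoImplicit false

noncomputable section

open scoped Classical

open WeierstrassCurve NumberField IsDedekindDomain Literature.NumberTheory.EllipticCurves
  Literature.NumberTheory.EllipticCurves.Rank1Residual Literature.NumberTheory.QuadraticFields

namespace Summit.BirchSwinnertonDyer.Rank1Residual.X11b

/-- `ord_p` of a finite product of non-zero naturals is the sum of the `ord_p`. [folklore] -/
private theorem padicValNat_finsetProd_odd {ι : Type*} (p : ℕ) [Fact p.Prime] (s : Finset ι)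
    (f : ι → ℕ) (hf : ∀ i ∈ s, f i ≠ 0) :
    padicValNat p (∏ i ∈ s, f i) = ∑ i ∈ s, padicValNat p (f i) := by
  classical
  induction s using Finset.induction_on with
  | empty => simp
  | insert a s ha ih =>
    rw [Finset.prod_insert ha, Finset.sum_insert ha,
      padicValNat.mul (hf a (Finset.mem_insert_self a s))
        (Finset.prod_ne_zero_iff.mpr fun i hi => hf i (Finset.mem_insert_of_mem hi)),
      ih fun i hi => hf i (Finset.mem_insert_of_mem hi)]

variable (W : WeierstrassCurve ℚ) [W.IsElliptic] [W.IsGloballyMinimal] (p : ℕ) [Fact p.Prime]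
  (K : Type) [Field K] [NumberField K] (Wd : WeierstrassCurve ℚ) [Wd.IsElliptic]

/-! ### §1 The fibrewise regrouping, with the per-place identity abstracted -/

omit [W.IsGloballyMinimal] in
/-- **`ord_p ∏_w c_w(E/K) = ord_p ∏_v c_v(E) + ord_p ∏_v c_v(Wd)` from the per-place identities
`Σ_{w ∣ v} ord_p c_w(E_K) = ord_p c_v(E) + ord_p c_v(Wd)` (all finite places `v` of `ℚ`).** For a
number field `K` and elliptic `W, Wd /ℚ`: the Tamagawa product of `E_K` is a finite product over the
places of `K`, regrouped along the finite fibres of `w ↦ w ∩ ℤ` (`Finset.sum_fiberwise_of_maps_to`).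
This is the proof transcript of `X11b.padicValNat_tamagawaProduct_baseChange_quadratic` (multr1-p1)
with its per-place lemma turned into the hypothesis `hfib`, so that the `p ≥ 5` identity and the
odd-`p` identity below are both instances. [cite: Castella2018, §5 (arXiv:1704.06608 p. 12), Tamagawa relation]
[cite: JetchevSkinnerWan2017, §7.3.1 (eq:tamK)] -/
theorem padicValNat_tamagawaProduct_baseChange_eq_of_fibre [(W.baseChange K).IsElliptic]
    (hfib : ∀ v : HeightOneSpectrum (𝓞 ℚ),
      (∑ w ∈ (HeightOneSpectrum.finite_setOf_under_eq_of_numberField (K := K) v).toFinset,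
          padicValNat p (((W.baseChange K).baseChange (w.adicCompletion K)).localTamagawaNumber
            (w.adicCompletionIntegers K))) =
        padicValNat p ((W.baseChange (v.adicCompletion ℚ)).localTamagawaNumber
            (v.adicCompletionIntegers ℚ)) +
          padicValNat p ((Wd.baseChange (v.adicCompletion ℚ)).localTamagawaNumber
            (v.adicCompletionIntegers ℚ))) :
    padicValNat p (W.baseChange K).tamagawaProduct =
      padicValNat p W.tamagawaProduct + padicValNat p Wd.tamagawaProduct := by
  -- the three local Tamagawa functions
  set cK : HeightOneSpectrum (𝓞 K) → ℕ := fun w =>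
    ((W.baseChange K).baseChange (w.adicCompletion K)).localTamagawaNumber
      (w.adicCompletionIntegers K) with hcK
  set cQ : HeightOneSpectrum (𝓞 ℚ) → ℕ := fun v =>
    (W.baseChange (v.adicCompletion ℚ)).localTamagawaNumber (v.adicCompletionIntegers ℚ) with hcQ
  set cD : HeightOneSpectrum (𝓞 ℚ) → ℕ := fun v =>
    (Wd.baseChange (v.adicCompletion ℚ)).localTamagawaNumber (v.adicCompletionIntegers ℚ) with hcD
  have hfinK : (Function.mulSupport cK).Finite :=
    (W.baseChange K).mulSupport_localTamagawaNumber_finite_holds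
  have hfinQ : (Function.mulSupport cQ).Finite := W.mulSupport_localTamagawaNumber_finite_holds
  have hfinD : (Function.mulSupport cD).Finite := Wd.mulSupport_localTamagawaNumber_finite_holds
  -- fibres of `K → ℚ` on places and the finite index sets
  set F : HeightOneSpectrum (𝓞 ℚ) → Finset (HeightOneSpectrum (𝓞 K)) := fun v =>
    (HeightOneSpectrum.finite_setOf_under_eq_of_numberField (K := K) v).toFinset with hF
  have hmemF : ∀ v w, w ∈ F v ↔ w.under (𝓞 ℚ) = v := fun v w => by
    simp [hF, Set.Finite.mem_toFinset]
  set SQ : Finset (HeightOneSpectrum (𝓞 ℚ)) :=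
    hfinK.toFinset.image (fun w => w.under (𝓞 ℚ)) ∪ hfinQ.toFinset ∪ hfinD.toFinset with hSQ
  set SK : Finset (HeightOneSpectrum (𝓞 K)) := SQ.biUnion F with hSK
  have hsubK : Function.mulSupport cK ⊆ ↑SK := by
    intro w hw
    rw [Finset.mem_coe, hSK, Finset.mem_biUnion]
    refine ⟨w.under (𝓞 ℚ), ?_, (hmemF _ _).mpr rfl⟩
    rw [hSQ, Finset.mem_union, Finset.mem_union, Finset.mem_image]
    exact Or.inl (Or.inl ⟨w, hfinK.mem_toFinset.mpr hw, rfl⟩)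
  have hsubQ : Function.mulSupport cQ ⊆ ↑SQ := fun v hv => by
    rw [Finset.mem_coe, hSQ, Finset.mem_union, Finset.mem_union]
    exact Or.inl (Or.inr (hfinQ.mem_toFinset.mpr hv))
  have hsubD : Function.mulSupport cD ⊆ ↑SQ := fun v hv => by
    rw [Finset.mem_coe, hSQ, Finset.mem_union, Finset.mem_union]
    exact Or.inr (hfinD.mem_toFinset.mpr hv)
  -- `ord_p` of the three products as sums over the index sets
  have hK' : padicValNat p (W.baseChange K).tamagawaProduct = ∑ w ∈ SK, padicValNat p (cK w) := by
    rw [show (W.baseChange K).tamagawaProduct = ∏ᶠ w, cK w from rfl,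
      finprod_eq_prod_of_mulSupport_subset cK hsubK]
    exact padicValNat_finsetProd_odd p SK cK fun w _ =>
      (W.baseChange K).localTamagawaNumber_baseChange_ne_zero w
  have hQ' : padicValNat p W.tamagawaProduct = ∑ v ∈ SQ, padicValNat p (cQ v) := by
    rw [show W.tamagawaProduct = ∏ᶠ v, cQ v from rfl,
      finprod_eq_prod_of_mulSupport_subset cQ hsubQ]
    exact padicValNat_finsetProd_odd p SQ cQ fun v _ => W.localTamagawaNumber_baseChange_ne_zero v
  have hD' : padicValNat p Wd.tamagawaProduct = ∑ v ∈ SQ, padicValNat p (cD v) := by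
    rw [show Wd.tamagawaProduct = ∏ᶠ v, cD v from rfl,
      finprod_eq_prod_of_mulSupport_subset cD hsubD]
    exact padicValNat_finsetProd_odd p SQ cD fun v _ => Wd.localTamagawaNumber_baseChange_ne_zero v
  -- regroup the `K`-side along the fibres
  have hmaps : ∀ w ∈ SK, w.under (𝓞 ℚ) ∈ SQ := by
    intro w hw
    rw [hSK, Finset.mem_biUnion] at hw
    obtain ⟨v, hv, hwv⟩ := hw
    rwa [(hmemF v w).mp hwv]
  have hfib' : ∀ v ∈ SQ, SK.filter (fun w => w.under (𝓞 ℚ) = v) = F v := by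
    intro v hv
    ext w
    simp only [Finset.mem_filter, hmemF]
    constructor
    · exact fun h => h.2
    · intro h
      refine ⟨?_, h⟩
      rw [hSK, Finset.mem_biUnion]
      exact ⟨v, hv, (hmemF v w).mpr h⟩
  rw [hK', hQ', hD', ← Finset.sum_fiberwise_of_maps_to hmaps, ← Finset.sum_add_distrib]
  refine Finset.sum_congr rfl fun v hv => ?_
  rw [hfib' v hv]
  exact hfib v

/-! ### §2 The per-place identity at every odd `p ∤ d_K` under the classical Heegner hypothesis -/

/-- **The Tamagawa relation, one rational place at a time, at every ODD prime `p ∤ d_K` under the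
classical Heegner hypothesis.** Let `W/ℚ` be globally minimal elliptic of conductor `N`, `p ≠ 2`, `K`
imaginary quadratic with `d_K` odd, `p ∤ d_K`, and EVERY `ℓ ∣ N` split in `K`; `Wd = C • W^{(d_K)}` an
elliptic model of the twist. Then for every finite place `v` of `ℚ`:
`Σ_{w ∣ v} ord_p c_w(E_K) = ord_p c_v(E) + ord_p c_v(Wd)` and `ord_p c_v(Wd) = ord_p c_v(E)`.
Split `v` (two places `w₁ ≠ w₂` of degree one): `c_{w_i}(E_K) = c_v(E)`
(`localTamagawaNumber_baseChange_eq_of_degree_one`) and `c_v(Wd) = c_v(E)` (`d_K ∈ (ℚ_v^×)²`,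
`isSquare_padic_discr_of_splitsIn`, `localTamagawaNumber_eq_of_twist_of_isSquare`) — verbatim the
`p ≥ 5` proof, which is `p`-free here. Non-split `v` (one `w ∣ v`): by the Heegner hypothesis
`ℓ ∤ N`, so `E` is good at `v` and `c_v(E) = 1` (`localTamagawaNumber_eq_one_of_good'`), `E_K` is good
at `w` and `c_w(E_K) = 1` (Silverman VII.5.1(a), `hasGoodReductionAt_baseChange_of_hasGoodReductionAt_rat`),
and `ord_p c_v(Wd) = ord_p c_v(E) = 0` (eisenstein-p2's `X2.padicValNat_localTamagawaNumber_twist_eq_of_odd`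
— type `I₀*` with `c ∈ {1,2,4}` at `ℓ ∣ d_K`, unramified twist elsewhere — transported to the adic
completion by `localTamagawaNumber_padic_eq_holds`). CGLS 2022, proof of Thm. 5.3.1: "for any prime
`ℓ` (see [Skinner–Zhang, Cor. 9.2])". [cite: CastellaGrossiLeeSkinner2022, proof of Thm. 5.3.1, sentence before (5.7)]
[cite: JetchevSkinnerWan2017, §7.3.1 (eq:tamK)] [cite: SilvermanAEC2009, VII.5 Prop. 5.1(a) and VII.6 Ex. 7.6] -/
theorem padicValNat_sum_fibre_eq_of_heegner_of_odd [(W.baseChange K).IsElliptic] (hp2 : p ≠ 2)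
    (hK : IsImaginaryQuadratic K) (hodd : Odd (NumberField.discr K))
    (hpd : ¬ (p : ℤ) ∣ NumberField.discr K) (hH : SatisfiesHeegnerHypothesis (W.conductorNorm ℤ) K)
    {C : VariableChange ℚ} (hC : C • W.quadraticTwist (NumberField.discr K : ℚ) = Wd)
    (v : HeightOneSpectrum (𝓞 ℚ)) :
    (∑ w ∈ (HeightOneSpectrum.finite_setOf_under_eq_of_numberField (K := K) v).toFinset,
        padicValNat p (((W.baseChange K).baseChange (w.adicCompletion K)).localTamagawaNumber
          (w.adicCompletionIntegers K)) =
      padicValNat p ((W.baseChange (v.adicCompletion ℚ)).localTamagawaNumber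
          (v.adicCompletionIntegers ℚ)) +
        padicValNat p ((Wd.baseChange (v.adicCompletion ℚ)).localTamagawaNumber
          (v.adicCompletionIntegers ℚ))) ∧
    padicValNat p ((Wd.baseChange (v.adicCompletion ℚ)).localTamagawaNumber
        (v.adicCompletionIntegers ℚ)) =
      padicValNat p ((W.baseChange (v.adicCompletion ℚ)).localTamagawaNumber
        (v.adicCompletionIntegers ℚ)) := by
  have h2 : Module.finrank ℚ K = 2 := hK.1
  set ℓ : ℕ := (Rat.HeightOneSpectrum.primesEquiv v : ℕ) with hℓdef
  haveI hℓ : Fact ℓ.Prime := ⟨(Rat.HeightOneSpectrum.primesEquiv v).2⟩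
  have hvℓ : (Rat.HeightOneSpectrum.primesEquiv v : ℕ) = ℓ := rfl
  have hd : (NumberField.discr K : ℚ) ≠ 0 := by exact_mod_cast NumberField.discr_ne_zero K
  have hfin := HeightOneSpectrum.finite_setOf_under_eq_of_numberField (K := K) v
  -- the second clause, at EVERY `v`: eisenstein-p2's twist lemma, moved to the adic completion
  have hsnd : padicValNat p ((Wd.baseChange (v.adicCompletion ℚ)).localTamagawaNumber
        (v.adicCompletionIntegers ℚ)) =
      padicValNat p ((W.baseChange (v.adicCompletion ℚ)).localTamagawaNumber
        (v.adicCompletionIntegers ℚ)) := by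
    rw [← WeierstrassCurve.localTamagawaNumber_padic_eq_holds Wd v ℓ hvℓ,
      ← WeierstrassCurve.localTamagawaNumber_padic_eq_holds W v ℓ hvℓ]
    exact X2.padicValNat_localTamagawaNumber_twist_eq_of_odd W p hp2 K hK hodd hpd hH C hC ℓ
  refine ⟨?_, hsnd⟩
  -- the case of a single place `w` above `v` (inert or ramified): `ℓ ∤ N`, all three are `p`-units
  have key : ∀ (w : HeightOneSpectrum (𝓞 K)),
      {w' : HeightOneSpectrum (𝓞 K) | w'.under (𝓞 ℚ) = v} = {w} →
      (∑ w ∈ hfin.toFinset,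
          padicValNat p (((W.baseChange K).baseChange (w.adicCompletion K)).localTamagawaNumber
            (w.adicCompletionIntegers K)) =
        padicValNat p ((W.baseChange (v.adicCompletion ℚ)).localTamagawaNumber
            (v.adicCompletionIntegers ℚ)) +
          padicValNat p ((Wd.baseChange (v.adicCompletion ℚ)).localTamagawaNumber
            (v.adicCompletionIntegers ℚ))) := by
    intro w hset
    have hw : w.under (𝓞 ℚ) = v := by
      have h : w ∈ ({w} : Set (HeightOneSpectrum (𝓞 K))) := Set.mem_singleton _
      rwa [← hset] at h
    have hF : hfin.toFinset = {w} := by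
      ext w'
      rw [Set.Finite.mem_toFinset, hset]
      simp
    -- `ℓ` does not split in `K`, hence `ℓ ∤ N` by the Heegner hypothesis
    have hns : ¬ SplitsIn K ℓ := by
      show ((Ideal.span {(ℓ : ℤ)}).primesOver (𝓞 K)).ncard ≠ 2
      rw [hℓdef, ncard_primesOver_span_eq K v, hset, Set.ncard_singleton]
      decide
    have hℓN : ¬ ℓ ∣ W.conductorNorm ℤ := fun h ↦ hns (hH ℓ hℓ.out h)
    have hgood : W.HasGoodReductionAtPrime ℓ := by
      by_contra hbad
      exact hℓN ((W.dvd_conductorNorm_iff_not_hasGoodReductionAtPrime ℓ).mpr hbad)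
    have hgoodv : W.HasGoodReductionAt v :=
      (hasGoodReductionAtPrime_primesEquiv_iff_holds W v ℓ hvℓ).mp hgood
    -- `c_v(E) = 1`
    have hQ : (W.baseChange (v.adicCompletion ℚ)).localTamagawaNumber (v.adicCompletionIntegers ℚ) =
        1 :=
      localTamagawaNumber_eq_one_of_good' v W
        (WeierstrassCurve.localTamagawaNumber_eq_one_of_hasGoodReduction_holds _ _) hgoodv
    -- `E_K` is good at `w`, `c_w(E_K) = 1`
    haveI : w.asIdeal.LiesOver v.asIdeal := by rw [← hw]; exact ⟨rfl⟩
    have hgoodw : (W.baseChange K).HasGoodReductionAt w :=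
      hasGoodReductionAt_baseChange_of_hasGoodReductionAt_rat W v w hgoodv
    have hKw : ((W.baseChange K).baseChange (w.adicCompletion K)).localTamagawaNumber
        (w.adicCompletionIntegers K) = 1 :=
      localTamagawaNumber_eq_one_of_good' w (W.baseChange K)
        (WeierstrassCurve.localTamagawaNumber_eq_one_of_hasGoodReduction_holds _ _) hgoodw
    rw [hF, Finset.sum_singleton, hKw, hsnd, hQ, padicValNat_one_right]
  rcases placesOver_trichotomy_of_finrank_eq_two K h2 v with
    ⟨w₁, w₂, hne, hset, hef⟩ | ⟨w, hset, -, -⟩ | ⟨w, hset, -, -⟩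
  · -- split: two places of degree one, and `d_K` is a square in `ℚ_ℓ`
    have hw₁ : w₁.under (𝓞 ℚ) = v := by
      have h : w₁ ∈ ({w₁, w₂} : Set (HeightOneSpectrum (𝓞 K))) := Set.mem_insert _ _
      rwa [← hset] at h
    have hw₂ : w₂.under (𝓞 ℚ) = v := by
      have h : w₂ ∈ ({w₁, w₂} : Set (HeightOneSpectrum (𝓞 K))) :=
        Set.mem_insert_of_mem _ (Set.mem_singleton _)
      rwa [← hset] at h
    obtain ⟨he₁, hf₁⟩ := hef w₁ hw₁
    obtain ⟨he₂, hf₂⟩ := hef w₂ hw₂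
    have hF : hfin.toFinset = {w₁, w₂} := by
      ext w
      rw [Set.Finite.mem_toFinset, hset]
      simp
    have hs : SplitsIn K ℓ := by
      show ((Ideal.span {(ℓ : ℤ)}).primesOver (𝓞 K)).ncard = 2
      rw [hℓdef, ncard_primesOver_span_eq K v, hset, Set.ncard_pair hne]
    have hsq := isSquare_padic_discr_of_splitsIn h2 hs
    have c₁ := localTamagawaNumber_baseChange_eq_of_degree_one W w₁ he₁ hf₁
    have c₂ := localTamagawaNumber_baseChange_eq_of_degree_one W w₂ he₂ hf₂
    rw [hw₁] at c₁
    rw [hw₂] at c₂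
    rw [hF, Finset.sum_pair hne, c₁, c₂,
      localTamagawaNumber_eq_of_twist_of_isSquare W v hvℓ hd hsq Wd hC]
  · exact key w hset
  · exact key w hset

/-! ### §3 The global identities at every odd `p ∤ d_K` -/

/-- **Tamagawa numbers in a quadratic base change, `p`-adically, at every ODD `p ∤ d_K` under the
classical Heegner hypothesis: `ord_p ∏_w c_w(E/K) = ord_p ∏_ℓ c_ℓ(E) + ord_p ∏_ℓ c_ℓ(E^{(d_K)})`**
(Castella 2018 §5's "immediate relation"; JSW 2017 (eq:tamK); CGLS 2022, proof of Thm. 5.3.1,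
"`Σ_{w∣ℓ} ord_p(c_w(E/K)) = ord_p(c_ℓ(E/ℚ)) + ord_p(c_ℓ(E^K/ℚ))` for any prime `ℓ`"), for `W/ℚ`
globally minimal elliptic, `K` imaginary quadratic with `d_K` odd and every `ℓ ∣ N` split, and any
elliptic model `Wd = C • E^{(d_K)}`. Extends multr1-p1's
`padicValNat_tamagawaProduct_baseChange_quadratic` (`p ≥ 5`, general `K`) to `p = 3` on the
classical-Heegner locus. [cite: CastellaGrossiLeeSkinner2022, proof of Thm. 5.3.1, sentence before (5.7)]
[cite: Castella2018, §5 (arXiv:1704.06608 p. 12), Tamagawa relation] [cite: JetchevSkinnerWan2017, §7.3.1 (eq:tamK)] -/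
theorem padicValNat_tamagawaProduct_baseChange_quadratic_of_heegner_of_odd (hp2 : p ≠ 2)
    (hK : IsImaginaryQuadratic K) (hodd : Odd (NumberField.discr K))
    (hpd : ¬ (p : ℤ) ∣ NumberField.discr K) (hH : SatisfiesHeegnerHypothesis (W.conductorNorm ℤ) K)
    {C : VariableChange ℚ} (hC : C • W.quadraticTwist (NumberField.discr K : ℚ) = Wd) :
    padicValNat p (W.baseChange K).tamagawaProduct =
      padicValNat p W.tamagawaProduct + padicValNat p Wd.tamagawaProduct := by
  haveI hEK : (W.baseChange K).IsElliptic := by rw [baseChange]; infer_instance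
  exact padicValNat_tamagawaProduct_baseChange_eq_of_fibre W p K Wd fun v =>
    (padicValNat_sum_fibre_eq_of_heegner_of_odd W p K Wd hp2 hK hodd hpd hH hC v).1

/-- **`ord_p ∏_ℓ c_ℓ(E^{(d_K)}) = ord_p ∏_ℓ c_ℓ(E)` in the adic-completion currency, at every odd
`p ∤ d_K` under the classical Heegner hypothesis** — the twist half, globalised from the per-place
clause (the `ℚ_ℓ`-currency statement is eisenstein-p2's
`X2.padicValNat_tamagawaProduct_twist_of_heegner_of_odd`; this is the same number, assembled here
over the places of `𝓞 ℚ` so that it combines with the base-change half without a change of index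
set). [cite: JetchevSkinnerWan2017, §7.3.1 (eq:tamK)] -/
theorem padicValNat_tamagawaProduct_quadraticTwist_eq_of_heegner_of_odd (hp2 : p ≠ 2)
    (hK : IsImaginaryQuadratic K) (hodd : Odd (NumberField.discr K))
    (hpd : ¬ (p : ℤ) ∣ NumberField.discr K) (hH : SatisfiesHeegnerHypothesis (W.conductorNorm ℤ) K)
    {C : VariableChange ℚ} (hC : C • W.quadraticTwist (NumberField.discr K : ℚ) = Wd) :
    padicValNat p Wd.tamagawaProduct = padicValNat p W.tamagawaProduct :=
  X2.padicValNat_tamagawaProduct_twist_of_heegner_of_odd W p hp2 K hK hodd hpd hH C hC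

/-- **`ord_p ∏_w c_w(E/K) = 2 · ord_p ∏_ℓ c_ℓ(E)` at every ODD `p ∤ d_K` under the classical Heegner
hypothesis** — the two halves combined; Jetchev–Skinner–Wan 2017 (eq:tamK)
"`∏_w c_w(E/K) = ∏_ℓ c_ℓ(E/ℚ)²`" read `p`-adically. This is the transport value `htamK` of
`CastellaGrossiLeeSkinner2022.indexIdentity_of_display55` / `RowC6.indexIdentityAt_of_display55`,
now available at `p = 3`. [cite: JetchevSkinnerWan2017, §7.3.1 (eq:tamK)]
[cite: CastellaGrossiLeeSkinner2022, proof of Thm. 5.3.1, sentence before (5.7)] -/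
theorem padicValNat_tamagawaProduct_baseChange_quadratic_eq_two_mul_of_heegner_of_odd (hp2 : p ≠ 2)
    (hK : IsImaginaryQuadratic K) (hodd : Odd (NumberField.discr K))
    (hpd : ¬ (p : ℤ) ∣ NumberField.discr K) (hH : SatisfiesHeegnerHypothesis (W.conductorNorm ℤ) K) :
    padicValNat p (W.baseChange K).tamagawaProduct = 2 * padicValNat p W.tamagawaProduct := by
  have hd : (NumberField.discr K : ℚ) ≠ 0 := by exact_mod_cast NumberField.discr_ne_zero K
  haveI := W.isElliptic_quadraticTwist hd
  rw [padicValNat_tamagawaProduct_baseChange_quadratic_of_heegner_of_odd W p K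
      (W.quadraticTwist (NumberField.discr K : ℚ)) hp2 hK hodd hpd hH (C := 1) (one_smul _ _),
    X2.padicValNat_tamagawaProduct_twist_of_heegner_of_odd W p hp2 K hK hodd hpd hH 1 (one_smul _ _),
    two_mul]

end Summit.BirchSwinnertonDyer.Rank1Residual.X11b

end
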